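import Literature.ComputerArithmetic.BlanchardHighamMary2020.FABsum
import Mathlib.Data.Matrix.Mul

/-!
# Blanchard–Higham–Lopez–Mary–Pranesh 2020: mixed precision block fused multiply-add —
# the model (2.6), matrix multiplication by a chain of block FMAs (Theorems 3.1–3.2),
# and LU factorization / linear systems with a `b × b` FMA (Corollary 4.1, Theorems 4.3–4.4)

HONEST FRAMING (ENGINES group, engine `quad`, part QUAD-4 — batched evaluation / code-generation
kernels / profiler): shared numerical engines serving client cells; rigour lives in the verifiers;
every published number belongs to a client cell's ledger, not to the engines group. This file types,
at MODEL LEVEL (rounding errors are bounded variables over a linearly ordered field `K`; no format is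
fixed), the rounding error analysis of a mixed precision BLOCK FMA `D = C + AB` — `A`, `B` stored at
precision `u_low`, `C`, `D` at `u_low` or `u_high`, the unit evaluating internally at precision `u`
and rounding its output once, to `u_FMA` — and of the algorithms built from it: one output entry of
the block FMA is `fmaAcc` ((2.5): left to right in precision `u`) followed by one output rounding,
giving the model (2.6); an entry of `C = AB` by Algorithm 3.1 is a CHAIN of `q = n/b` block FMAs
(`chainFMA`), whose backward form `ŝ_n = Σ xᵢyᵢ(1 + αᵢ)(1 + βᵢ)`, `|αᵢ| ≤ γ̃_q^FMA`, `|βᵢ| ≤ γ_n`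
gives (3.4), Theorem 3.1 (3.5) and — with the conversion errors of `A`, `B` to `u_low` —
Theorem 3.2 (3.6); started at an entry of `A` instead of `0` the same chain is the Schur update of
Corollary 4.1 (4.1), from which the entrywise backward error (4.6)/(4.4) of the LU factorization
(Theorem 4.3) and (4.7) of the linear solve (Theorem 4.4) follow.

SOURCE. P. Blanchard, N. J. Higham, F. Lopez, T. Mary, S. Pranesh, *Mixed precision block fused
multiply-add: error analysis and application to GPU tensor cores*, SIAM J. Sci. Comput. 42(3)
(2020) C124–C141, doi 10.1137/19M1289546 [cite: BlanchardHighamLopezMaryPranesh2020]; read at the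
page in the authors' version hal-02491076v2 (PDF pages: p. 5 = §2.1 eqs. (2.3)–(2.6); p. 6 = §2.2
(2.7) and §3.1 Algorithm 3.1; p. 7 = §3.2 (3.1)–(3.3) and the display before (3.4); p. 8 = (3.4),
Table 3.1, Theorem 3.1 (3.5), Theorem 3.2 (3.6); p. 10 = Table 3.3; pp. 11–12 = §4.1 Corollary 4.1
(4.1), Algorithm 4.1; p. 13 = Lemma 4.2 (4.2)–(4.3), Theorem 4.3 (4.4); p. 14 = (4.5)–(4.6),
Theorem 4.4 (4.7); p. 15 = Table 4.1). Its reference [17] is Higham, *Accuracy and Stability of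
Numerical Algorithms*, 2nd ed. [cite: Higham2002ASNA]: `γ_k = ku/(1-ku)` is `Higham2002.gamma`,
[17, Lem. 3.1] is
`Higham2002.one_add_pow_sub_one_le_gamma`; the two-factor lemma `|(1+α)(1+β) - 1| ≤ (1+a)(1+b) - 1`
is `BlanchardHighamMary2020.abs_one_add_mul_one_add_sub_one_le` [cite: BlanchardHighamMary2020].

DICTIONARY (paper ↦ this file).
* Precisions `u_low`, `u_high`, `u` (internal), `u_FMA` (output of the unit), `ũ_FMA` (3.3) ↦
  nonnegative elements `ul`, `u`, `uF`, `v` of `K`; the standard model (2.3)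
  `fl(a op b) = (a op b)(1 + δ)`, `|δ| ≤ u` ↦ explicit error variables `ε`, `δ`, `η`, `λ`, `e`, `f`
  with hypotheses `|·| ≤ unit`; the form (2.4) ↦ `(1 + δ') d̂ = d̃` (`eq26`). "We assume that
  `ku < 1` for the relevant integers `k`" ↦ the hypotheses `(k : K) * u < 1` of each statement.
* `1 + θ_k`, `|θ_k| ≤ γ_k` ([17, Lems. 3.1, 3.3]) ↦ `IsTheta u k t : (1-u)^k ≤ t ≤ (1+u)^k` with
  `IsTheta.mul` (orders add), `IsTheta.abs_sub_one_le_gamma` (`|t - 1| ≤ γ_k` if `ku < 1`).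
* One output entry of `C + AB` "computed at precision `u`", "from left to right" (Theorem 3.1's
  standing assumption) ↦ `fmaAcc c x y ε δ b = (⋯((c + x₀y₀(1+ε₀))(1+δ₀) + x₁y₁(1+ε₁))(1+δ₁)⋯)`;
  INDEXING is 0-based: block `i' < q`, position `k < b`, flat inner index `l = i'b + k`
  (`sum_range_mul_eq_sum_sum`); "for `i = 1`, since `s₀ = 0`, (3.2) holds with `b + 1` replaced by
  `b`" (the first addition onto `0` is exact) ↦ the hypothesis `δ 0 0 = 0`.
* `ŝ_i` of (3.1)–(3.2) ↦ `chainFMA b c x y ε δ η i` (`c = 0` in Algorithm 3.1, `c =` an entry of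
  `A` in Corollary 4.1, where the `X_j` enter negated: `corollary41_sub`).
* Matrices: in Theorems 3.1/3.2 rows and columns are indexed by arbitrary types and the inner
  dimension by `l < qb`, `|C - Ĉ| ≤ c|A||B|` entrywise; Theorem 4.3 is typed AT ONE ENTRY of one
  block, over finite index sets `J` (previous blocks) and `T` (inner positions); Theorem 4.4 over
  `Matrix n n K` with `Matrix.mulVec`.

TYPED AND PROVED: the `IsTheta` calculus; the backward and forward error of `fmaAcc` (the
"`|D̃ - D| ≤ γ_{b+1}(|C| + |A||B|)`" step, in the sharper form `((1+u)^b - 1)|c| + ((1+u)^{b+1} - 1)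
Σ|x||y|`); the model (2.6) (`eq26`); (3.3) with its precedence rule, the TC16/TC32 value `0` and the
`ũ_FMA` column of Table 3.1; the backward form of the chain for a general start value and for
`s₀ = 0` (`chainFMA_backward`, `chainFMA_zero_backward`, `chainFMA_eq_sum_alpha_beta`); (3.4) in the
sharp product form `((1+ũ_FMA)^q(1+u)^n - 1)|x|ᵀ|y|` and as printed (`eq34_pow`, `eq34`);
Theorem 3.1 (3.5) and Theorem 3.2 (3.6) (`theorem31`, `theorem32`); the rows of Tables 3.1/3.3 that
are identities of the constant (`ũ_FMA = 0 ⇒ γ_n`, `u = 0 ⇒ γ̃_q^FMA`); Corollary 4.1 (4.1) in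
`+` and `-` form; Theorem 4.3 per entry — from a Corollary-4.1-type bound `θ₁` on `R̂_ik`, a
Lemma-4.2-type bound `θ₂` ((4.5)) and the conversions `L̃ = L̂(1+e)`, `Ũ = Û(1+f)`,
`|e|, |f| ≤ u_low`, the conclusion (4.6) with `max(θ₁, θ₂)` (`theorem43_entry`; the source takes
`θ₁ = γ̃_{q-1}^FMA + γ_{n-b+1} + γ̃_{q-1}^FMA γ_{n-b+1}`, `θ₂ = γ_b`); Theorem 4.4 (4.7)
(`theorem44`, the argument of [17, Thm. 9.4]).
NOT TYPED: Algorithms 3.1/4.1 as programs on concrete formats and the binary16/binary32 values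
(`u₁₆ = 2⁻¹¹`, `u₃₂ = 2⁻²⁴`) of Tables 3.2/4.1 — only model-level statements; Lemma 4.2 itself
(= [17, Thms. 9.3, 8.5]) and the substitution bounds of Theorem 4.4, which enter as hypotheses
(`hR`, `h45`, `hy`/`hΔL`, `hx`/`hΔU`); the assembly of the per-entry (4.6) over the block pattern
of Algorithm 4.1 into the matrix statement (4.4) (block triangularity bookkeeping only); the
first-order "`≲`" columns of Tables 3.1, 3.3, 4.1 beyond the exact identities above; the
right-to-left variant ("`γ_n` can be replaced by `γ_{q+b-1}`") and "(3.4) is valid for all orders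
of evaluation"; the second rounding when `u > u_FMA > u` and double rounding [30]; the probabilistic
bounds [18], [19]; §3.3 and §4.2 (experiments, cuBLAS, iterative refinement), all figures/timings.
DEDUP: nearest in-tree statements are `BlanchardHighamMary2020/FABsum.lean` (blocked summation
`FABsum` and its use for matrix products) and `Summits/Ventures/CertifiedArithmetic/LowPrec/
AccumulateTwoLevel.lean` (two-level accumulation in two formats, citing this paper "cf. §3");
neither has the block-FMA chain with internal / output / storage precisions, (2.6), (3.3)–(3.6),
(4.1), (4.6) or (4.7), which are new statements here; `gamma`, its Lemma-3.1 bound and the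
two-factor lemma are imported, not restated.
-/

namespace Literature.ComputerArithmetic.BlanchardHighamLopezMaryPranesh2020

open Finset Literature.ComputerArithmetic.Higham2002
open Literature.ComputerArithmetic.BlanchardHighamMary2020 (abs_one_add_mul_one_add_sub_one_le)

variable {K : Type*} [Field K] [LinearOrder K] [IsStrictOrderedRing K]

/-! ## Accumulated relative perturbations `1 + θ_N` -/

/-- `IsTheta u N t`: `t` is an accumulated relative perturbation factor of order `N` for the unit
roundoff `u`, i.e. `(1 - u)^N ≤ t ≤ (1 + u)^N` — the shape of every product `∏_{i<N} (1 + δᵢ)` with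
`|δᵢ| ≤ u`; in the source's (and Higham's) notation `t = 1 + θ_N`, `|θ_N| ≤ γ_N`.
[cite: BlanchardHighamLopezMaryPranesh2020, §3.2 ("where `|θ_k| ≤ γ_k`")] -/
def IsTheta (u : K) (N : ℕ) (t : K) : Prop := (1 - u) ^ N ≤ t ∧ t ≤ (1 + u) ^ N

namespace IsTheta

/-- One rounding error `1 + δ`, `|δ| ≤ u`, is a factor of order `1`.
[cite: BlanchardHighamLopezMaryPranesh2020, §2.1 eq. (2.3)] -/
theorem one_add {u δ : K} (h : |δ| ≤ u) : IsTheta u 1 (1 + δ) := by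
  obtain ⟨h1, h2⟩ := abs_le.mp h
  refine ⟨?_, ?_⟩ <;> rw [pow_one] <;> linarith

/-- The exact factor `1` has every order. [cite: BlanchardHighamLopezMaryPranesh2020, §3.2] -/
theorem one_right {u : K} (hu : 0 ≤ u) (hu1 : u ≤ 1) (N : ℕ) : IsTheta u N 1 :=
  ⟨pow_le_one₀ (by linarith) (by linarith), one_le_pow₀ (by linarith)⟩

/-- A perturbation factor is nonnegative (`u ≤ 1`). [cite: BlanchardHighamLopezMaryPranesh2020, §3.2] -/
theorem nonneg {u : K} (hu1 : u ≤ 1) {N : ℕ} {t : K} (h : IsTheta u N t) : 0 ≤ t :=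
  le_trans (pow_nonneg (by linarith) N) h.1

/-- Orders ADD under multiplication: `(1 + θ_N)(1 + θ_M) = 1 + θ_{N+M}`.
[cite: BlanchardHighamLopezMaryPranesh2020, §3.2 (use of [17, Lem. 3.3])] -/
theorem mul {u : K} (hu : 0 ≤ u) (hu1 : u ≤ 1) {N M : ℕ} {t t' : K}
    (h : IsTheta u N t) (h' : IsTheta u M t') : IsTheta u (N + M) (t * t') := by
  refine ⟨?_, ?_⟩
  · rw [pow_add]
    exact mul_le_mul h.1 h'.1 (pow_nonneg (by linarith) M) (h.nonneg hu1)
  · rw [pow_add]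
    exact mul_le_mul h.2 h'.2 (h'.nonneg hu1) (pow_nonneg (by linarith) N)

/-- The order may be increased. [cite: BlanchardHighamLopezMaryPranesh2020, §3.2] -/
theorem mono {u : K} (hu : 0 ≤ u) (hu1 : u ≤ 1) {N M : ℕ} (hNM : N ≤ M) {t : K}
    (h : IsTheta u N t) : IsTheta u M t := by
  refine ⟨le_trans ?_ h.1, le_trans h.2 ?_⟩
  · exact pow_le_pow_of_le_one (by linarith) (by linarith) hNM
  · exact pow_le_pow_right₀ (by linarith) hNM

omit [IsStrictOrderedRing K] in
/-- Transport along an equality of orders. [cite: BlanchardHighamLopezMaryPranesh2020, §3.2] -/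
theorem of_eq {u : K} {N M : ℕ} {t : K} (h : IsTheta u N t) (e : N = M) : IsTheta u M t := e ▸ h

/-- `2 ≤ (1 + u)^N + (1 - u)^N` (`0 ≤ u ≤ 1`): the lower deviation `1 - (1 - u)^N` never exceeds the
upper one `(1 + u)^N - 1`. [cite: BlanchardHighamLopezMaryPranesh2020, §3.2] -/
theorem two_le_pow_add_pow {u : K} (hu : 0 ≤ u) (hu1 : u ≤ 1) :
    ∀ N : ℕ, 2 ≤ (1 + u) ^ N + (1 - u) ^ N
  | 0 => by norm_num
  | N + 1 => by
      have ih := two_le_pow_add_pow hu hu1 N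
      have hle : (1 - u) ^ N ≤ (1 + u) ^ N := pow_le_pow_left₀ (by linarith) (by linarith) N
      rw [pow_succ, pow_succ]
      nlinarith

/-- `|θ_N| ≤ (1 + u)^N - 1` (sharp product form). [cite: BlanchardHighamLopezMaryPranesh2020, §3.2] -/
theorem abs_sub_one_le {u : K} (hu : 0 ≤ u) (hu1 : u ≤ 1) {N : ℕ} {t : K} (h : IsTheta u N t) :
    |t - 1| ≤ (1 + u) ^ N - 1 := by
  have h2 := two_le_pow_add_pow hu hu1 N
  rw [abs_le]
  constructor <;> linarith [h.1, h.2]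

/-- `|θ_N| ≤ γ_N` when `Nu < 1` ([17, Lem. 3.1] as used throughout §3.2).
[cite: BlanchardHighamLopezMaryPranesh2020, §3.2 ("where `|θ_k| ≤ γ_k`")] -/
theorem abs_sub_one_le_gamma {u : K} (hu : 0 ≤ u) (hu1 : u ≤ 1) {N : ℕ} (hN : (N : K) * u < 1)
    {t : K} (h : IsTheta u N t) : |t - 1| ≤ gamma u N :=
  le_trans (h.abs_sub_one_le hu hu1) (one_add_pow_sub_one_le_gamma hu hN)

/-- Two factors of different unit roundoffs compose: if `a = 1 + α` has order `Q` for `v` and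
`c = 1 + β` has order `N` for `u` then `|ac - 1| ≤ (1 + v)^Q (1 + u)^N - 1` — the source's
`(1 + αᵢ)(1 + βᵢ)`. [cite: BlanchardHighamLopezMaryPranesh2020, §3.2 (display before (3.4))] -/
theorem abs_mul_sub_one_le {u v : K} (hu : 0 ≤ u) (hu1 : u ≤ 1) (hv : 0 ≤ v) (hv1 : v ≤ 1)
    {Q N : ℕ} {a c : K} (ha : IsTheta v Q a) (hc : IsTheta u N c) :
    |a * c - 1| ≤ (1 + v) ^ Q * (1 + u) ^ N - 1 := by
  have h := abs_one_add_mul_one_add_sub_one_le (ha.abs_sub_one_le hv hv1) (hc.abs_sub_one_le hu hu1)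
  have e1 : (1 + (a - 1)) * (1 + (c - 1)) - 1 = a * c - 1 := by ring
  have e2 : (1 + ((1 + v) ^ Q - 1)) * (1 + ((1 + u) ^ N - 1)) - 1 = (1 + v) ^ Q * (1 + u) ^ N - 1 := by
    ring
  rw [e1, e2] at h
  exact h

/-- The `γ` form of the composition: `|(1 + α)(1 + β) - 1| ≤ γ̃_Q + γ_N + γ̃_Q γ_N`
(`γ̃ = γ(v)`, `γ = γ(u)`). [cite: BlanchardHighamLopezMaryPranesh2020, §3.2 eq. (3.4)] -/
theorem abs_mul_sub_one_le_gamma {u v : K} (hu : 0 ≤ u) (hu1 : u ≤ 1) (hv : 0 ≤ v) (hv1 : v ≤ 1)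
    {Q N : ℕ} (hQ : (Q : K) * v < 1) (hN : (N : K) * u < 1) {a c : K} (ha : IsTheta v Q a)
    (hc : IsTheta u N c) :
    |a * c - 1| ≤ gamma v Q + gamma u N + gamma v Q * gamma u N := by
  have h := abs_one_add_mul_one_add_sub_one_le (ha.abs_sub_one_le_gamma hv hv1 hQ)
    (hc.abs_sub_one_le_gamma hu hu1 hN)
  have e1 : (1 + (a - 1)) * (1 + (c - 1)) - 1 = a * c - 1 := by ring
  have e2 : (1 + gamma v Q) * (1 + gamma u N) - 1 = gamma v Q + gamma u N + gamma v Q * gamma u N := by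
    ring
  rw [e1, e2] at h
  exact h

end IsTheta

/-! ## §2.1 / §3.2: one block FMA — internal evaluation at precision `u`, left to right -/

/-- The INTERNAL evaluation of one block FMA output entry at precision `u`, left to right as in
(3.1)–(3.2): starting from the incoming value `s` (an entry of `C`, resp. the previous partial sum
`ŝ_{i-1}`), `t₀ = s`, `t_{k+1} = (t_k + x_k y_k (1 + ε_k))(1 + δ_k)` — each product and each
addition in the model (2.3) with `|ε_k|, |δ_k| ≤ u`. `fmaAcc s x y ε δ m` is `t_m`.
[cite: BlanchardHighamLopezMaryPranesh2020, §3.2 eqs. (3.1)–(3.2)] -/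
def fmaAcc (s : K) (x y ε δ : ℕ → K) : ℕ → K
  | 0 => s
  | k + 1 => (fmaAcc s x y ε δ k + x k * y k * (1 + ε k)) * (1 + δ k)

omit [LinearOrder K] [IsStrictOrderedRing K] in
/-- With no rounding errors the internal evaluation is exact — the reading `u = 0` of the model,
i.e. the "rounded exact result" (2.1). [cite: BlanchardHighamLopezMaryPranesh2020, §2.1 eqs. (2.1), (2.6) ("Setting `u = 0` corresponds to (2.1)")] -/
theorem fmaAcc_exact (s : K) (x y ε δ : ℕ → K) (hε : ∀ k, ε k = 0) (hδ : ∀ k, δ k = 0) :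
    ∀ m : ℕ, fmaAcc s x y ε δ m = s + ∑ k ∈ range m, x k * y k
  | 0 => by simp [fmaAcc]
  | m + 1 => by
      rw [fmaAcc, fmaAcc_exact s x y ε δ hε hδ m, Finset.sum_range_succ, hε m, hδ m]
      ring

/-- (3.2), BACKWARD FORM of one block FMA's internal evaluation: `t_m = s(1 + θ_m) + Σ_{k<m}
x_k y_k (1 + θ^{(k)}_{m+1})` — the incoming value collects `m` rounding errors (the `m` additions),
each product at most `m + 1` (its multiplication and the additions after it).
[cite: BlanchardHighamLopezMaryPranesh2020, §3.2 eq. (3.2)] -/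
theorem fmaAcc_backward {u : K} (hu : 0 ≤ u) (hu1 : u ≤ 1) (s : K) (x y ε δ : ℕ → K)
    (hε : ∀ k, |ε k| ≤ u) (hδ : ∀ k, |δ k| ≤ u) :
    ∀ m : ℕ, ∃ T : K, ∃ t : ℕ → K, IsTheta u m T ∧ (∀ k < m, IsTheta u (m + 1) (t k)) ∧
      fmaAcc s x y ε δ m = s * T + ∑ k ∈ range m, x k * y k * t k
  | 0 => ⟨1, fun _ => 1, IsTheta.one_right hu hu1 0, fun k hk => absurd hk (Nat.not_lt_zero k),
      by simp [fmaAcc]⟩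
  | m + 1 => by
      obtain ⟨T, t, hT, ht, heq⟩ := fmaAcc_backward hu hu1 s x y ε δ hε hδ m
      refine ⟨T * (1 + δ m),
        fun k => if k < m then t k * (1 + δ m) else (1 + ε m) * (1 + δ m),
        hT.mul hu hu1 (IsTheta.one_add (hδ m)), fun k hk => ?_, ?_⟩
      · dsimp only
        by_cases hkm : k < m
        · rw [if_pos hkm]
          exact (ht k hkm).mul hu hu1 (IsTheta.one_add (hδ m))
        · rw [if_neg hkm]
          exact ((IsTheta.one_add (hε m)).mul hu hu1 (IsTheta.one_add (hδ m))).mono hu hu1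
            (by omega)
      · dsimp only
        rw [fmaAcc, heq, Finset.sum_range_succ, if_neg (lt_irrefl m)]
        have hs : ∑ k ∈ range m, x k * y k * (if k < m then t k * (1 + δ m) else (1 + ε m) * (1 + δ m))
            = (∑ k ∈ range m, x k * y k * t k) * (1 + δ m) := by
          rw [Finset.sum_mul]
          refine Finset.sum_congr rfl fun k hk => ?_
          rw [if_pos (Finset.mem_range.mp hk)]
          ring
        rw [hs]
        ring

/-- (3.2) for the FIRST block (`i = 1`): the incoming value is `s₀ = 0` and adding the first product
to it commits no error (`δ₀ = 0`), so "(3.2) holds with `b + 1` replaced by `b`": every product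
collects at most `m` rounding errors. [cite: BlanchardHighamLopezMaryPranesh2020, §3.2 (remark after (3.3))] -/
theorem fmaAcc_zero_backward {u : K} (hu : 0 ≤ u) (hu1 : u ≤ 1) (x y ε δ : ℕ → K)
    (hε : ∀ k, |ε k| ≤ u) (hδ : ∀ k, |δ k| ≤ u) (hδ0 : δ 0 = 0) :
    ∀ m : ℕ, ∃ t : ℕ → K, (∀ k < m, IsTheta u m (t k)) ∧
      fmaAcc 0 x y ε δ m = ∑ k ∈ range m, x k * y k * t k
  | 0 => ⟨fun _ => 1, fun k hk => absurd hk (Nat.not_lt_zero k), by simp [fmaAcc]⟩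
  | m + 1 => by
      obtain ⟨t, ht, heq⟩ := fmaAcc_zero_backward hu hu1 x y ε δ hε hδ hδ0 m
      refine ⟨fun k => if k < m then t k * (1 + δ m) else (1 + ε m) * (1 + δ m),
        fun k hk => ?_, ?_⟩
      · dsimp only
        by_cases hkm : k < m
        · rw [if_pos hkm]
          exact (ht k hkm).mul hu hu1 (IsTheta.one_add (hδ m))
        · rw [if_neg hkm]
          rcases Nat.eq_zero_or_pos m with hm0 | hmpos
          · subst hm0
            have e : (1 + ε 0) * (1 + δ 0) = 1 + ε 0 := by rw [hδ0]; ring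
            rw [e]
            exact IsTheta.one_add (hε 0)
          · exact ((IsTheta.one_add (hε m)).mul hu hu1 (IsTheta.one_add (hδ m))).mono hu hu1
              (by omega)
      · dsimp only
        rw [fmaAcc, heq, Finset.sum_range_succ, if_neg (lt_irrefl m)]
        have hs : ∑ k ∈ range m, x k * y k * (if k < m then t k * (1 + δ m) else (1 + ε m) * (1 + δ m))
            = (∑ k ∈ range m, x k * y k * t k) * (1 + δ m) := by
          rw [Finset.sum_mul]
          refine Finset.sum_congr rfl fun k hk => ?_
          rw [if_pos (Finset.mem_range.mp hk)]
          ring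
        rw [hs]
        ring

/-- FORWARD bound of one block FMA's internal evaluation (the "standard analysis for matrix
multiplication [17, sect. 3.5]" step of §2.1, sharp product form):
`|t_m - (s + Σ_{k<m} x_k y_k)| ≤ ((1+u)^m - 1)|s| + ((1+u)^{m+1} - 1) Σ_{k<m} |x_k||y_k|`.
[cite: BlanchardHighamLopezMaryPranesh2020, §2.1 (display before (2.5))] -/
theorem abs_fmaAcc_sub_le {u : K} (hu : 0 ≤ u) (hu1 : u ≤ 1) (s : K) (x y ε δ : ℕ → K)
    (hε : ∀ k, |ε k| ≤ u) (hδ : ∀ k, |δ k| ≤ u) (m : ℕ) :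
    |fmaAcc s x y ε δ m - (s + ∑ k ∈ range m, x k * y k)|
      ≤ ((1 + u) ^ m - 1) * |s| + ((1 + u) ^ (m + 1) - 1) * ∑ k ∈ range m, |x k| * |y k| := by
  obtain ⟨T, t, hT, ht, heq⟩ := fmaAcc_backward hu hu1 s x y ε δ hε hδ m
  rw [heq]
  have e : s * T + ∑ k ∈ range m, x k * y k * t k - (s + ∑ k ∈ range m, x k * y k)
      = s * (T - 1) + ∑ k ∈ range m, x k * y k * (t k - 1) := by
    have e2 : ∑ k ∈ range m, x k * y k * (t k - 1)
        = ∑ k ∈ range m, x k * y k * t k - ∑ k ∈ range m, x k * y k := by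
      rw [← Finset.sum_sub_distrib]
      exact Finset.sum_congr rfl fun k _ => by ring
    rw [e2]
    ring
  rw [e]
  have h1 : |s * (T - 1)| ≤ ((1 + u) ^ m - 1) * |s| := by
    rw [abs_mul, mul_comm]
    exact mul_le_mul_of_nonneg_right (hT.abs_sub_one_le hu hu1) (abs_nonneg s)
  have h2 : |∑ k ∈ range m, x k * y k * (t k - 1)|
      ≤ ((1 + u) ^ (m + 1) - 1) * ∑ k ∈ range m, |x k| * |y k| := by
    refine le_trans (Finset.abs_sum_le_sum_abs _ _) ?_
    rw [Finset.mul_sum]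
    refine Finset.sum_le_sum fun k hk => ?_
    rw [abs_mul, abs_mul]
    have := (ht k (Finset.mem_range.mp hk)).abs_sub_one_le hu hu1
    have h0 : 0 ≤ |x k| * |y k| := mul_nonneg (abs_nonneg _) (abs_nonneg _)
    nlinarith
  exact le_trans (abs_add_le _ _) (add_le_add h1 h2)


/-- If `N u < 1` for some `N ≥ 1` then `u ≤ 1` (the standing assumption "`ku < 1` for the relevant
integers `k`" contains `u < 1`). [cite: BlanchardHighamLopezMaryPranesh2020, §2.1 (after (2.4))] -/
theorem le_one_of_mul_lt_one {u : K} {N : ℕ} (hN1 : 1 ≤ N) (hN : (N : K) * u < 1) :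
    u ≤ 1 := by
  have h1 : (1 : K) ≤ (N : K) := by exact_mod_cast hN1
  nlinarith

/-! ## §2.1 eqs. (2.5)–(2.6): the model of one mixed-precision block FMA -/

/-- THE BLOCK FMA MODEL (2.6). One output entry `d = c + Σ_{k<b} x_k y_k` of `D = C + AB`
(`A ∈ K^{b₁×b}`, `B ∈ K^{b×b₂}`): the block FMA computes `d̃ = fmaAcc c x y ε δ b` at precision
`u` (`|ε_k|, |δ_k| ≤ u`) and then rounds it to the output precision `u_FMA` in the form (2.4)/(2.5),
`(1 + δ') d̂ = d̃` with `|δ'| ≤ u_FMA`. Then `|d̂ - d| ≤ u_FMA |d̂| + γ_{b+1} (|c| + Σ_k |x_k||y_k|)`.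
[cite: BlanchardHighamLopezMaryPranesh2020, §2.1 eqs. (2.5)–(2.6)] -/
theorem eq26 {u uF : K} (hu : 0 ≤ u) {b : ℕ} (hb : ((b + 1 : ℕ) : K) * u < 1)
    (c : K) (x y ε δ : ℕ → K) (hε : ∀ k, |ε k| ≤ u) (hδ : ∀ k, |δ k| ≤ u) {dhat δ' : K}
    (hδ' : |δ'| ≤ uF) (hround : (1 + δ') * dhat = fmaAcc c x y ε δ b) :
    |dhat - (c + ∑ k ∈ range b, x k * y k)|
      ≤ uF * |dhat| + gamma u (b + 1) * (|c| + ∑ k ∈ range b, |x k| * |y k|) := by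
  have hu1 : u ≤ 1 := le_one_of_mul_lt_one (by omega) hb
  have h1 := abs_fmaAcc_sub_le hu hu1 c x y ε δ hε hδ b
  set d := c + ∑ k ∈ range b, x k * y k with hd
  set S := ∑ k ∈ range b, |x k| * |y k| with hS
  have hS0 : 0 ≤ S := Finset.sum_nonneg fun k _ => mul_nonneg (abs_nonneg _) (abs_nonneg _)
  have hg := one_add_pow_sub_one_le_gamma hu hb
  have hpow : (1 + u) ^ b - 1 ≤ (1 + u) ^ (b + 1) - 1 := by
    have := pow_le_pow_right₀ (show (1 : K) ≤ 1 + u by linarith) (Nat.le_add_right b 1)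
    linarith
  have h2 : |fmaAcc c x y ε δ b - d| ≤ gamma u (b + 1) * (|c| + S) := by
    refine le_trans h1 ?_
    have hc0 := abs_nonneg c
    nlinarith
  have e : dhat - d = (fmaAcc c x y ε δ b - d) - δ' * dhat := by rw [← hround]; ring
  rw [e]
  have h3 : |δ' * dhat| ≤ uF * |dhat| := by
    rw [abs_mul]; exact mul_le_mul_of_nonneg_right hδ' (abs_nonneg _)
  calc |fmaAcc c x y ε δ b - d - δ' * dhat|
      ≤ |fmaAcc c x y ε δ b - d| + |δ' * dhat| := abs_sub _ _
    _ ≤ gamma u (b + 1) * (|c| + S) + uF * |dhat| := add_le_add h2 h3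
    _ = uF * |dhat| + gamma u (b + 1) * (|c| + S) := by ring

/-! ## §3.2 eq. (3.3): the effective output-rounding unit `ũ_FMA` -/

/-- EQUATION (3.3), the unit roundoff `ũ_FMA` of the ONE rounding that follows the internal
evaluation of each block FMA in Algorithm 3.1 (`|δ_i| ≤ ũ_FMA` in (3.2)). The source writes the
letter `u` both for the INTERNAL precision of the block FMA (§2.1: "`C + AB` is computed at precision
`u ≤ u_FMA` and then rounded to precision `u_FMA`") and for the precision of the OUTPUT `C` of
Algorithm 3.1 ("The output `C` is in precision `u`"; line 8: "If `u ≠ u_FMA` then round `C_ij` to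
precision `u`"; "two roundings will be needed if `u > u_FMA > u`", of which only one is kept). We
therefore carry both: `uC` = the output precision of `C`, `u` = the internal precision. (3.3) reads
`ũ_FMA = u (= uC)` if `uC > u_FMA` ("taking the first choice if the first condition is satisfied"),
else `0` if `u ≥ u_FMA` (no rounding error: the internal result is representable), else `u_FMA`
(`u < u_FMA`). With `uC = u` this is the display (3.3) verbatim; with `uC = u_FMA` it is the `ũ_FMA`
column of Table 3.1 (`uTilde_table31`). All error bounds below take the output unit `v = ũ_FMA` as a
free nonnegative parameter. [cite: BlanchardHighamLopezMaryPranesh2020, §3.2 eq. (3.3); §3.1 Algorithm 3.1 (line 8)] -/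
def uTilde (uC u uFMA : K) : K := if uFMA < uC then uC else if u < uFMA then uFMA else 0

omit [IsStrictOrderedRing K] in
/-- (3.3), first case: the output `C` is held in a precision coarser than `u_FMA`.
[cite: BlanchardHighamLopezMaryPranesh2020, §3.2 eq. (3.3)] -/
theorem uTilde_of_lt {uC u uFMA : K} (h : uFMA < uC) : uTilde uC u uFMA = uC := by
  simp [uTilde, h]

omit [IsStrictOrderedRing K] in
/-- (3.3), second case (`u ≥ u_FMA`, output not coarser than `u_FMA`): no rounding error.
[cite: BlanchardHighamLopezMaryPranesh2020, §3.2 eq. (3.3)] -/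
theorem uTilde_of_ge {uC u uFMA : K} (hC : uC ≤ uFMA) (h : uFMA ≤ u) : uTilde uC u uFMA = 0 := by
  simp [uTilde, not_lt.mpr hC, not_lt.mpr h]

omit [IsStrictOrderedRing K] in
/-- (3.3), third case (`u < u_FMA`): the rounding to the output format costs `u_FMA`.
[cite: BlanchardHighamLopezMaryPranesh2020, §3.2 eq. (3.3)] -/
theorem uTilde_of_gt {uC u uFMA : K} (hC : uC ≤ uFMA) (h : u < uFMA) : uTilde uC u uFMA = uFMA := by
  simp [uTilde, not_lt.mpr hC, h]

omit [IsStrictOrderedRing K] in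
/-- The tensor cores: TC16 (`u = u_FMA = u₁₆`, `C` in fp16) and TC32 (`u = u_FMA = u₃₂`, `C` in fp32)
of (2.7) — "We have `ũ_FMA = 0` in (3.3) in both cases".
[cite: BlanchardHighamLopezMaryPranesh2020, §2.2 eq. (2.7); §4.1 (before Table 4.1)] -/
theorem uTilde_self (u : K) : uTilde u u u = 0 := by
  simp [uTilde]

omit [IsStrictOrderedRing K] in
/-- The `ũ_FMA` column of Table 3.1 (output at precision `u_FMA`): `ũ_FMA = u_FMA` if `u < u_FMA`,
else `0` — rows `(u_FMA, u) = (u_low, u_low) ↦ 0`, `(u_low, u_high) ↦ u_low`, `(u_low, 0) ↦ u_low`,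
`(u_high, u_low) ↦ 0`, `(u_high, u_high) ↦ 0`, `(u_high, 0) ↦ u_high` (`0 < u_high < u_low`).
[cite: BlanchardHighamLopezMaryPranesh2020, §3.2 Table 3.1] -/
theorem uTilde_table31 (u uFMA : K) : uTilde uFMA u uFMA = if u < uFMA then uFMA else 0 := by
  simp [uTilde]

/-- `ũ_FMA ≥ 0` (given only `u_FMA ≥ 0`: in the first case `uC > u_FMA`).
[cite: BlanchardHighamLopezMaryPranesh2020, §3.2 eq. (3.3)] -/
theorem uTilde_nonneg {uC u uFMA : K} (hF : 0 ≤ uFMA) : 0 ≤ uTilde uC u uFMA := by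
  unfold uTilde
  split_ifs <;> linarith

omit [IsStrictOrderedRing K] in
/-- `ũ_FMA ≤ max(uC, u_FMA)`. [cite: BlanchardHighamLopezMaryPranesh2020, §3.2 eq. (3.3)] -/
theorem uTilde_le_max {uC u uFMA : K} (hC : 0 ≤ uC) : uTilde uC u uFMA ≤ max uC uFMA := by
  unfold uTilde
  split_ifs
  · exact le_max_left _ _
  · exact le_max_right _ _
  · exact le_trans hC (le_max_left _ _)

/-! ## §3.1–§3.2: Algorithm 3.1 — one entry of `C = AB` as a chain of `q` block FMAs -/

/-- ALGORITHM 3.1, one output entry (eqs. (3.1)–(3.2)): starting from `ŝ₀ = c` (`= 0` in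
Algorithm 3.1; `=` an entry of `A` in Corollary 4.1), block `i` (`i = 0, …, q-1`) feeds `ŝ_i` and
its `b` products `x i k · y i k` (`k < b`) through one block FMA — internal evaluation `fmaAcc` at
precision `u` (errors `ε i k`, `δ i k`), then the rounding of the output, `· (1 + η_i)` with
`|η_i| ≤ ũ_FMA` (the `δ_i` of (3.2)). `chainFMA b c x y ε δ η q = ŝ_q`.
[cite: BlanchardHighamLopezMaryPranesh2020, §3.1 Algorithm 3.1; §3.2 eqs. (3.1)–(3.2)] -/
def chainFMA (b : ℕ) (c : K) (x y ε δ : ℕ → ℕ → K) (η : ℕ → K) : ℕ → K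
  | 0 => c
  | i + 1 => fmaAcc (chainFMA b c x y ε δ η i) (x i) (y i) (ε i) (δ i) b * (1 + η i)

omit [LinearOrder K] [IsStrictOrderedRing K] in
/-- Without rounding errors the chain is the exact `c + Σ_{i<q} Σ_{k<b} x i k · y i k`.
[cite: BlanchardHighamLopezMaryPranesh2020, §3.2 eq. (3.1)] -/
theorem chainFMA_exact (b : ℕ) (c : K) (x y ε δ : ℕ → ℕ → K) (η : ℕ → K)
    (hε : ∀ i k, ε i k = 0) (hδ : ∀ i k, δ i k = 0) (hη : ∀ i, η i = 0) :
    ∀ q : ℕ, chainFMA b c x y ε δ η q = c + ∑ i ∈ range q, ∑ k ∈ range b, x i k * y i k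
  | 0 => by simp [chainFMA]
  | q + 1 => by
      rw [chainFMA, chainFMA_exact b c x y ε δ η hε hδ hη q,
        fmaAcc_exact _ _ _ _ _ (hε q) (hδ q), hη q, Finset.sum_range_succ]
      ring

/-- BACKWARD FORM OF THE CHAIN, general start value `c` (the display before (3.4), with the extra
term `c`): `ŝ_i = c (1 + α)(1 + β) + Σ_{i'<i} Σ_{k<b} x i' k · y i' k · (1 + α_{i'k})(1 + β_{i'k})`
where the `α` collect the OUTPUT roundings (`1 + α_{i'k}` of order `i - i'` for `ũ_FMA`, the
start value's of order `i`) and the `β` the INTERNAL ones (of order `i·b + 1` for `u`; the start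
value's of order `i·b`). [cite: BlanchardHighamLopezMaryPranesh2020, §3.2 (from (3.2) to (3.4)); §4.1 proof of Corollary 4.1] -/
theorem chainFMA_backward {u v : K} (hu : 0 ≤ u) (hu1 : u ≤ 1) (hv : 0 ≤ v) (hv1 : v ≤ 1)
    (b : ℕ) (c : K) (x y ε δ : ℕ → ℕ → K) (η : ℕ → K) (hε : ∀ i k, |ε i k| ≤ u)
    (hδ : ∀ i k, |δ i k| ≤ u) (hη : ∀ i, |η i| ≤ v) :
    ∀ i : ℕ, ∃ A C : K, ∃ a d : ℕ → ℕ → K, IsTheta v i A ∧ IsTheta u (i * b) C ∧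
      (∀ i' < i, ∀ k < b, IsTheta v (i - i') (a i' k) ∧ IsTheta u (i * b + 1) (d i' k)) ∧
      chainFMA b c x y ε δ η i
        = c * (A * C) + ∑ i' ∈ range i, ∑ k ∈ range b, x i' k * y i' k * (a i' k * d i' k)
  | 0 => ⟨1, 1, fun _ _ => 1, fun _ _ => 1, IsTheta.one_right hv hv1 0,
      (IsTheta.one_right hu hu1 0).of_eq (by simp), fun i' hi' => absurd hi' (Nat.not_lt_zero _),
      by simp [chainFMA]⟩
  | i + 1 => by
      obtain ⟨A, C, a, d, hA, hC, had, heq⟩ :=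
        chainFMA_backward hu hu1 hv hv1 b c x y ε δ η hε hδ hη i
      obtain ⟨T, t, hT, ht, hfe⟩ :=
        fmaAcc_backward hu hu1 (chainFMA b c x y ε δ η i) (x i) (y i) (ε i) (δ i) (hε i) (hδ i) b
      refine ⟨A * (1 + η i), C * T,
        fun i' k => if i' < i then a i' k * (1 + η i) else 1 + η i,
        fun i' k => if i' < i then d i' k * T else t k,
        hA.mul hv hv1 (IsTheta.one_add (hη i)), (hC.mul hu hu1 hT).of_eq (by ring), ?_, ?_⟩
      · intro i' hi' k hk
        dsimp only
        by_cases h : i' < i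
        · rw [if_pos h, if_pos h]
          obtain ⟨ha, hd⟩ := had i' h k hk
          exact ⟨(ha.mul hv hv1 (IsTheta.one_add (hη i))).of_eq (by omega),
            (hd.mul hu hu1 hT).of_eq (by ring)⟩
        · rw [if_neg h, if_neg h]
          have hi'i : i' = i := by omega
          rw [hi'i]
          refine ⟨(IsTheta.one_add (hη i)).of_eq (by omega), (ht k hk).mono hu hu1 ?_⟩
          rw [Nat.succ_mul]
          omega
      · dsimp only
        rw [chainFMA, hfe, heq, Finset.sum_range_succ]
        have hs : ∑ i' ∈ range i, ∑ k ∈ range b, x i' k * y i' k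
              * ((if i' < i then a i' k * (1 + η i) else 1 + η i)
                * (if i' < i then d i' k * T else t k))
            = (∑ i' ∈ range i, ∑ k ∈ range b, x i' k * y i' k * (a i' k * d i' k))
              * (T * (1 + η i)) := by
          rw [Finset.sum_mul]
          refine Finset.sum_congr rfl fun i' hi' => ?_
          rw [Finset.sum_mul]
          refine Finset.sum_congr rfl fun k _ => ?_
          rw [if_pos (mem_range.mp hi'), if_pos (mem_range.mp hi')]
          ring
        have hs2 : ∑ k ∈ range b, x i k * y i k
              * ((if i < i then a i k * (1 + η i) else 1 + η i) * (if i < i then d i k * T else t k))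
            = (∑ k ∈ range b, x i k * y i k * t k) * (1 + η i) := by
          rw [Finset.sum_mul]
          refine Finset.sum_congr rfl fun k _ => ?_
          rw [if_neg (lt_irrefl i), if_neg (lt_irrefl i)]
          ring
        rw [hs, hs2]
        ring

/-- BACKWARD FORM OF ALGORITHM 3.1's CHAIN (`ŝ₀ = 0`, the first addition exact): the display
before (3.4), `ŝ_n = Σᵢ xᵢ yᵢ (1 + αᵢ)(1 + βᵢ)` — here after `i` blocks, `1 + α_{i'k}` of order
`i - i'` for `ũ_FMA` (at most `q`) and `1 + β_{i'k}` of order `i·b` for `u` (`= n` at `i = q`,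
"using `qb = n`"). [cite: BlanchardHighamLopezMaryPranesh2020, §3.2 (display before (3.4))] -/
theorem chainFMA_zero_backward {u v : K} (hu : 0 ≤ u) (hu1 : u ≤ 1) (hv : 0 ≤ v) (hv1 : v ≤ 1)
    {b : ℕ} (hb : 0 < b) (x y ε δ : ℕ → ℕ → K) (η : ℕ → K) (hε : ∀ i k, |ε i k| ≤ u)
    (hδ : ∀ i k, |δ i k| ≤ u) (hδ0 : δ 0 0 = 0) (hη : ∀ i, |η i| ≤ v) :
    ∀ i : ℕ, ∃ a d : ℕ → ℕ → K,
      (∀ i' < i, ∀ k < b, IsTheta v (i - i') (a i' k) ∧ IsTheta u (i * b) (d i' k)) ∧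
      chainFMA b 0 x y ε δ η i
        = ∑ i' ∈ range i, ∑ k ∈ range b, x i' k * y i' k * (a i' k * d i' k)
  | 0 => ⟨fun _ _ => 1, fun _ _ => 1, fun i' hi' => absurd hi' (Nat.not_lt_zero _),
      by simp [chainFMA]⟩
  | i + 1 => by
      rcases Nat.eq_zero_or_pos i with hi0 | hipos
      · -- the first block: `ŝ₁ = fl(x₀y₀ + … )·(1 + η₀)`, no incoming value
        subst hi0
        obtain ⟨t, ht, hfe⟩ :=
          fmaAcc_zero_backward hu hu1 (x 0) (y 0) (ε 0) (δ 0) (hε 0) (hδ 0) hδ0 b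
        refine ⟨fun _ _ => 1 + η 0, fun _ k => t k, fun i' hi' k hk => ⟨?_, ?_⟩, ?_⟩
        · exact (IsTheta.one_add (hη 0)).of_eq (by omega)
        · exact (ht k hk).of_eq (by simp)
        · rw [chainFMA, chainFMA, hfe, zero_add, Finset.sum_range_one, Finset.sum_mul]
          exact Finset.sum_congr rfl fun k _ => by ring
      · obtain ⟨a, d, had, heq⟩ :=
          chainFMA_zero_backward hu hu1 hv hv1 hb x y ε δ η hε hδ hδ0 hη i
        obtain ⟨T, t, hT, ht, hfe⟩ :=
          fmaAcc_backward hu hu1 (chainFMA b 0 x y ε δ η i) (x i) (y i) (ε i) (δ i) (hε i) (hδ i) b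
        refine ⟨fun i' k => if i' < i then a i' k * (1 + η i) else 1 + η i,
          fun i' k => if i' < i then d i' k * T else t k, ?_, ?_⟩
        · intro i' hi' k hk
          dsimp only
          by_cases h : i' < i
          · rw [if_pos h, if_pos h]
            obtain ⟨ha, hd⟩ := had i' h k hk
            exact ⟨(ha.mul hv hv1 (IsTheta.one_add (hη i))).of_eq (by omega),
              (hd.mul hu hu1 hT).of_eq (by ring)⟩
          · rw [if_neg h, if_neg h]
            have hi'i : i' = i := by omega
            rw [hi'i]
            refine ⟨(IsTheta.one_add (hη i)).of_eq (by omega), (ht k hk).mono hu hu1 ?_⟩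
            have hbi : b ≤ i * b := Nat.le_mul_of_pos_left b hipos
            rw [Nat.succ_mul]
            omega
        · dsimp only
          rw [chainFMA, hfe, heq, Finset.sum_range_succ]
          have hs : ∑ i' ∈ range i, ∑ k ∈ range b, x i' k * y i' k
                * ((if i' < i then a i' k * (1 + η i) else 1 + η i)
                  * (if i' < i then d i' k * T else t k))
              = (∑ i' ∈ range i, ∑ k ∈ range b, x i' k * y i' k * (a i' k * d i' k))
                * (T * (1 + η i)) := by
            rw [Finset.sum_mul]
            refine Finset.sum_congr rfl fun i' hi' => ?_
            rw [Finset.sum_mul]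
            refine Finset.sum_congr rfl fun k _ => ?_
            rw [if_pos (mem_range.mp hi'), if_pos (mem_range.mp hi')]
            ring
          have hs2 : ∑ k ∈ range b, x i k * y i k
                * ((if i < i then a i k * (1 + η i) else 1 + η i)
                  * (if i < i then d i k * T else t k))
              = (∑ k ∈ range b, x i k * y i k * t k) * (1 + η i) := by
            rw [Finset.sum_mul]
            refine Finset.sum_congr rfl fun k _ => ?_
            rw [if_neg (lt_irrefl i), if_neg (lt_irrefl i)]
            ring
          rw [hs, hs2]
          ring

/-- From termwise factor bounds to the error of a double sum: if `|f i k - 1| ≤ M` for all terms then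
`|Σ Σ x y f - Σ Σ x y| ≤ M · Σ Σ |x||y|`. [cite: BlanchardHighamLopezMaryPranesh2020, §3.2 ("Hence (3.4)")] -/
theorem abs_sum_sum_mul_sub_le {q b : ℕ} (x y f : ℕ → ℕ → K) {M : K}
    (hf : ∀ i < q, ∀ k < b, |f i k - 1| ≤ M) :
    |∑ i ∈ range q, ∑ k ∈ range b, x i k * y i k * f i k
        - ∑ i ∈ range q, ∑ k ∈ range b, x i k * y i k|
      ≤ M * ∑ i ∈ range q, ∑ k ∈ range b, |x i k| * |y i k| := by
  have e : ∑ i ∈ range q, ∑ k ∈ range b, x i k * y i k * f i k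
        - ∑ i ∈ range q, ∑ k ∈ range b, x i k * y i k
      = ∑ i ∈ range q, ∑ k ∈ range b, x i k * y i k * (f i k - 1) := by
    rw [← Finset.sum_sub_distrib]
    refine Finset.sum_congr rfl fun i _ => ?_
    rw [← Finset.sum_sub_distrib]
    exact Finset.sum_congr rfl fun k _ => by ring
  rw [e, Finset.mul_sum]
  refine le_trans (Finset.abs_sum_le_sum_abs _ _) (Finset.sum_le_sum fun i hi => ?_)
  rw [Finset.mul_sum]
  refine le_trans (Finset.abs_sum_le_sum_abs _ _) (Finset.sum_le_sum fun k hk => ?_)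
  rw [abs_mul, abs_mul]
  have h0 : 0 ≤ |x i k| * |y i k| := mul_nonneg (abs_nonneg _) (abs_nonneg _)
  have := hf i (mem_range.mp hi) k (mem_range.mp hk)
  calc |x i k| * |y i k| * |f i k - 1| ≤ |x i k| * |y i k| * M :=
        mul_le_mul_of_nonneg_left this h0
    _ = M * (|x i k| * |y i k|) := by ring

/-- (3.4), SHARP PRODUCT FORM: `|s_n - ŝ_n| ≤ ((1 + ũ_FMA)^q (1 + u)^n - 1) |x|ᵀ|y|` (`n = qb`).
[cite: BlanchardHighamLopezMaryPranesh2020, §3.2 eq. (3.4)] -/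
theorem eq34_pow {u v : K} (hu : 0 ≤ u) (hu1 : u ≤ 1) (hv : 0 ≤ v) (hv1 : v ≤ 1) {b : ℕ}
    (hb : 0 < b) (x y ε δ : ℕ → ℕ → K) (η : ℕ → K) (hε : ∀ i k, |ε i k| ≤ u)
    (hδ : ∀ i k, |δ i k| ≤ u) (hδ0 : δ 0 0 = 0) (hη : ∀ i, |η i| ≤ v) (q : ℕ) :
    |chainFMA b 0 x y ε δ η q - ∑ i ∈ range q, ∑ k ∈ range b, x i k * y i k|
      ≤ ((1 + v) ^ q * (1 + u) ^ (q * b) - 1) * ∑ i ∈ range q, ∑ k ∈ range b, |x i k| * |y i k| := by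
  obtain ⟨a, d, had, heq⟩ := chainFMA_zero_backward hu hu1 hv hv1 hb x y ε δ η hε hδ hδ0 hη q
  rw [heq]
  refine abs_sum_sum_mul_sub_le x y (fun i k => a i k * d i k) fun i hi k hk => ?_
  obtain ⟨ha, hd⟩ := had i hi k hk
  exact IsTheta.abs_mul_sub_one_le hu hu1 hv hv1 (ha.mono hv hv1 (Nat.sub_le q i)) hd

/-- EQUATION (3.4): `|s_n - ŝ_n| ≤ (γ̃_q^FMA + γ_n + γ̃_q^FMA γ_n) |x|ᵀ|y|`, where `s_n = xᵀy` has
`n = qb` terms (block `i`, position `k` ↦ term `ib + k`), `ŝ_n` is Algorithm 3.1's chain of `q`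
block FMAs (internal precision `u`, left to right; output roundings `|η_i| ≤ ũ_FMA =: v`; the first
addition, onto `s₀ = 0`, exact), `γ_n = γ_n(u)`, `γ̃_q^FMA = γ_q(ũ_FMA)`, `qũ_FMA < 1`, `nu < 1`.
[cite: BlanchardHighamLopezMaryPranesh2020, §3.2 eq. (3.4)] -/
theorem eq34 {u v : K} (hu : 0 ≤ u) (hv : 0 ≤ v) {q b : ℕ} (hb : 0 < b) (hq : (q : K) * v < 1)
    (hn : ((q * b : ℕ) : K) * u < 1) (x y ε δ : ℕ → ℕ → K) (η : ℕ → K)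
    (hε : ∀ i k, |ε i k| ≤ u) (hδ : ∀ i k, |δ i k| ≤ u) (hδ0 : δ 0 0 = 0) (hη : ∀ i, |η i| ≤ v) :
    |chainFMA b 0 x y ε δ η q - ∑ i ∈ range q, ∑ k ∈ range b, x i k * y i k|
      ≤ (gamma v q + gamma u (q * b) + gamma v q * gamma u (q * b))
        * ∑ i ∈ range q, ∑ k ∈ range b, |x i k| * |y i k| := by
  rcases Nat.eq_zero_or_pos q with hq0 | hqpos
  · subst hq0
    simp [chainFMA]
  have hu1 : u ≤ 1 := le_one_of_mul_lt_one (Nat.mul_pos hqpos hb) hn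
  have hv1 : v ≤ 1 := le_one_of_mul_lt_one hqpos hq
  obtain ⟨a, d, had, heq⟩ := chainFMA_zero_backward hu hu1 hv hv1 hb x y ε δ η hε hδ hδ0 hη q
  rw [heq]
  refine abs_sum_sum_mul_sub_le x y (fun i k => a i k * d i k) fun i hi k hk => ?_
  obtain ⟨ha, hd⟩ := had i hi k hk
  exact IsTheta.abs_mul_sub_one_le_gamma hu hu1 hv hv1 hq hn (ha.mono hv hv1 (Nat.sub_le q i)) hd

/-- The display before (3.4) LITERALLY: `ŝ_n = Σᵢ xᵢyᵢ(1 + αᵢ)(1 + βᵢ)` with `|αᵢ| ≤ γ̃_q^FMA` and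
`|βᵢ| ≤ γ_n` ("by [17, Lems. 3.1, 3.3] and using `qb = n`").
[cite: BlanchardHighamLopezMaryPranesh2020, §3.2 (display before (3.4))] -/
theorem chainFMA_eq_sum_alpha_beta {u v : K} (hu : 0 ≤ u) (hv : 0 ≤ v) {q b : ℕ} (hb : 0 < b)
    (hq : (q : K) * v < 1) (hn : ((q * b : ℕ) : K) * u < 1) (x y ε δ : ℕ → ℕ → K) (η : ℕ → K)
    (hε : ∀ i k, |ε i k| ≤ u) (hδ : ∀ i k, |δ i k| ≤ u) (hδ0 : δ 0 0 = 0) (hη : ∀ i, |η i| ≤ v) :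
    ∃ α β : ℕ → ℕ → K, (∀ i < q, ∀ k < b, |α i k| ≤ gamma v q ∧ |β i k| ≤ gamma u (q * b)) ∧
      chainFMA b 0 x y ε δ η q
        = ∑ i ∈ range q, ∑ k ∈ range b, x i k * y i k * (1 + α i k) * (1 + β i k) := by
  rcases Nat.eq_zero_or_pos q with hq0 | hqpos
  · subst hq0
    exact ⟨fun _ _ => 0, fun _ _ => 0, fun i hi => absurd hi (Nat.not_lt_zero _), by simp [chainFMA]⟩
  have hu1 : u ≤ 1 := le_one_of_mul_lt_one (Nat.mul_pos hqpos hb) hn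
  have hv1 : v ≤ 1 := le_one_of_mul_lt_one hqpos hq
  obtain ⟨a, d, had, heq⟩ := chainFMA_zero_backward hu hu1 hv hv1 hb x y ε δ η hε hδ hδ0 hη q
  refine ⟨fun i k => a i k - 1, fun i k => d i k - 1, fun i hi k hk => ?_, ?_⟩
  · obtain ⟨ha, hd⟩ := had i hi k hk
    exact ⟨(ha.mono hv hv1 (Nat.sub_le q i)).abs_sub_one_le_gamma hv hv1 hq,
      hd.abs_sub_one_le_gamma hu hu1 hn⟩
  · rw [heq]
    refine Finset.sum_congr rfl fun i _ => Finset.sum_congr rfl fun k _ => by ring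

/-! ## §3.2 THEOREM 3.1 and THEOREM 3.2: the product `C = AB` by Algorithm 3.1 -/

omit [LinearOrder K] [IsStrictOrderedRing K] in
/-- Block indexing: the `n = qb` inner indices `l` split as `l = ib + k`, block `i < q`, position
`k < b` ("we assume that `q = n/b` is an integer").
[cite: BlanchardHighamLopezMaryPranesh2020, §3.1 (partitioning in Algorithm 3.1)] -/
theorem sum_range_mul_eq_sum_sum (f : ℕ → K) (q b : ℕ) :
    ∑ l ∈ range (q * b), f l = ∑ i ∈ range q, ∑ k ∈ range b, f (i * b + k) := by
  induction q with
  | zero => simp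
  | succ q ih => rw [Nat.succ_mul, Finset.sum_range_add, ih, Finset.sum_range_succ]

/-- THEOREM 3.1 (eq. (3.5)). Let `C = AB`, `A ∈ K^{m×n}`, `B ∈ K^{n×t}` given in precision `u_low`
(no conversion error), `n = qb`, be evaluated by Algorithm 3.1: every entry `ĉ i j` is the chain of
`q` block FMAs over the blocks of row `i` of `A` and column `j` of `B` (internal precision `u`,
left to right; output roundings of unit `v = ũ_FMA`; its own rounding errors). If `qũ_FMA < 1` and
`nu < 1` then, entrywise, `|C - Ĉ| ≤ (γ̃_q^FMA + γ_n + γ̃_q^FMA γ_n) |A||B|`. Rows and columns are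
indexed by arbitrary types, the inner dimension by `l < qb`.
[cite: BlanchardHighamLopezMaryPranesh2020, §3.2 Theorem 3.1 eq. (3.5)] -/
theorem theorem31 {ι ρ : Type*} {u v : K} (hu : 0 ≤ u) (hv : 0 ≤ v) {q b : ℕ} (hb : 0 < b)
    (hq : (q : K) * v < 1) (hn : ((q * b : ℕ) : K) * u < 1)
    (A : ι → ℕ → K) (B : ℕ → ρ → K) (Chat : ι → ρ → K)
    (hC : ∀ i j, ∃ ε δ : ℕ → ℕ → K, ∃ η : ℕ → K, (∀ i' k, |ε i' k| ≤ u) ∧ (∀ i' k, |δ i' k| ≤ u) ∧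
      δ 0 0 = 0 ∧ (∀ i', |η i'| ≤ v) ∧
      Chat i j = chainFMA b 0 (fun i' k => A i (i' * b + k)) (fun i' k => B (i' * b + k) j) ε δ η q) :
    ∀ i j, |∑ l ∈ range (q * b), A i l * B l j - Chat i j|
      ≤ (gamma v q + gamma u (q * b) + gamma v q * gamma u (q * b))
        * ∑ l ∈ range (q * b), |A i l| * |B l j| := by
  intro i j
  obtain ⟨ε, δ, η, hε, hδ, hδ0, hη, hCij⟩ := hC i j
  rw [hCij, abs_sub_comm, sum_range_mul_eq_sum_sum (fun l => A i l * B l j),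
    sum_range_mul_eq_sum_sum (fun l => |A i l| * |B l j|)]
  exact eq34 hu hv hb hq hn _ _ ε δ η hε hδ hδ0 hη

/-- THEOREM 3.2 (eq. (3.6)). As Theorem 3.1 but `A` and `B` NOT given in precision `u_low`: line 1 of
Algorithm 3.1 first converts them, `Ã = fl_low(A) = A + ΔA`, `|ΔA| ≤ u_low|A|` and likewise `B̃`
(entrywise, the model (2.3): `ã = a(1 + λ)`, `|λ| ≤ u_low`), and the chains run on `Ã`, `B̃`. Then
`|C - Ĉ| ≤ (2u_low + u_low² + (γ̃_q^FMA + γ_n + γ̃_q^FMA γ_n)(1 + u_low)²) |A||B|`.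
[cite: BlanchardHighamLopezMaryPranesh2020, §3.2 Theorem 3.2 eq. (3.6)] -/
theorem theorem32 {ι ρ : Type*} {u v ul : K} (hu : 0 ≤ u) (hv : 0 ≤ v) (hul : 0 ≤ ul) {q b : ℕ}
    (hb : 0 < b) (hq : (q : K) * v < 1) (hn : ((q * b : ℕ) : K) * u < 1)
    (A At : ι → ℕ → K) (B Bt : ℕ → ρ → K) (Chat : ι → ρ → K)
    (hA : ∀ i l, ∃ lam : K, |lam| ≤ ul ∧ At i l = A i l * (1 + lam))
    (hB : ∀ l j, ∃ lam : K, |lam| ≤ ul ∧ Bt l j = B l j * (1 + lam))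
    (hC : ∀ i j, ∃ ε δ : ℕ → ℕ → K, ∃ η : ℕ → K, (∀ i' k, |ε i' k| ≤ u) ∧ (∀ i' k, |δ i' k| ≤ u) ∧
      δ 0 0 = 0 ∧ (∀ i', |η i'| ≤ v) ∧
      Chat i j
        = chainFMA b 0 (fun i' k => At i (i' * b + k)) (fun i' k => Bt (i' * b + k) j) ε δ η q) :
    ∀ i j, |∑ l ∈ range (q * b), A i l * B l j - Chat i j|
      ≤ (2 * ul + ul ^ 2
          + (gamma v q + gamma u (q * b) + gamma v q * gamma u (q * b)) * (1 + ul) ^ 2)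
        * ∑ l ∈ range (q * b), |A i l| * |B l j| := by
  intro i j
  choose lamA hlamA using hA
  choose lamB hlamB using hB
  set θ := gamma v q + gamma u (q * b) + gamma v q * gamma u (q * b) with hθ
  have hθ0 : 0 ≤ θ := by
    have h1 := gamma_nonneg hv hq
    have h2 := gamma_nonneg hu hn
    positivity
  -- Theorem 3.1 for the converted matrices
  have h31 := theorem31 hu hv hb hq hn At Bt Chat hC i j
  set n := q * b with hn'
  set S := ∑ l ∈ range n, |A i l| * |B l j| with hS
  have hS0 : 0 ≤ S := Finset.sum_nonneg fun l _ => mul_nonneg (abs_nonneg _) (abs_nonneg _)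
  -- `Σ |Ã||B̃| ≤ (1 + u_low)² Σ |A||B|`
  have hconv : ∑ l ∈ range n, |At i l| * |Bt l j| ≤ (1 + ul) ^ 2 * S := by
    rw [hS, Finset.mul_sum]
    refine Finset.sum_le_sum fun l _ => ?_
    obtain ⟨ha, hAt⟩ := hlamA i l
    obtain ⟨hb', hBt⟩ := hlamB l j
    rw [hAt, hBt, abs_mul, abs_mul]
    have h1 : |1 + lamA i l| ≤ 1 + ul := by
      refine le_trans (abs_add_le _ _) ?_
      rw [abs_one]; linarith
    have h2 : |1 + lamB l j| ≤ 1 + ul := by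
      refine le_trans (abs_add_le _ _) ?_
      rw [abs_one]; linarith
    have hx := abs_nonneg (A i l)
    have hy := abs_nonneg (B l j)
    have h12 : |1 + lamA i l| * |1 + lamB l j| ≤ (1 + ul) * (1 + ul) :=
      mul_le_mul h1 h2 (abs_nonneg _) (by linarith)
    calc |A i l| * |1 + lamA i l| * (|B l j| * |1 + lamB l j|)
        = (|A i l| * |B l j|) * (|1 + lamA i l| * |1 + lamB l j|) := by ring
      _ ≤ (|A i l| * |B l j|) * ((1 + ul) * (1 + ul)) :=
          mul_le_mul_of_nonneg_left h12 (mul_nonneg hx hy)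
      _ = (1 + ul) ^ 2 * (|A i l| * |B l j|) := by ring
  -- `Σ AB - Σ ÃB̃ = -(ΔA B + A ΔB + ΔA ΔB)`, bounded by `(2u_low + u_low²) Σ |A||B|`
  have hdata : |∑ l ∈ range n, At i l * Bt l j - ∑ l ∈ range n, A i l * B l j|
      ≤ (2 * ul + ul ^ 2) * S := by
    have e : ∑ l ∈ range n, At i l * Bt l j - ∑ l ∈ range n, A i l * B l j
        = ∑ l ∈ range n, A i l * B l j * ((1 + lamA i l) * (1 + lamB l j) - 1) := by
      rw [← Finset.sum_sub_distrib]
      refine Finset.sum_congr rfl fun l _ => ?_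
      rw [(hlamA i l).2, (hlamB l j).2]; ring
    rw [e, hS, Finset.mul_sum]
    refine le_trans (Finset.abs_sum_le_sum_abs _ _) (Finset.sum_le_sum fun l _ => ?_)
    rw [abs_mul, abs_mul]
    have h := abs_one_add_mul_one_add_sub_one_le (hlamA i l).1 (hlamB l j).1
    have e2 : (1 + ul) * (1 + ul) - 1 = 2 * ul + ul ^ 2 := by ring
    rw [e2] at h
    have h0 : 0 ≤ |A i l| * |B l j| := mul_nonneg (abs_nonneg _) (abs_nonneg _)
    calc |A i l| * |B l j| * |(1 + lamA i l) * (1 + lamB l j) - 1|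
        ≤ |A i l| * |B l j| * (2 * ul + ul ^ 2) := mul_le_mul_of_nonneg_left h h0
      _ = (2 * ul + ul ^ 2) * (|A i l| * |B l j|) := by ring
  have htri : |∑ l ∈ range n, A i l * B l j - Chat i j|
      ≤ |∑ l ∈ range n, At i l * Bt l j - ∑ l ∈ range n, A i l * B l j|
        + |∑ l ∈ range n, At i l * Bt l j - Chat i j| := by
    have := abs_sub_le (∑ l ∈ range n, A i l * B l j) (∑ l ∈ range n, At i l * Bt l j) (Chat i j)
    rw [abs_sub_comm (∑ l ∈ range n, A i l * B l j) (∑ l ∈ range n, At i l * Bt l j)] at this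
    exact this
  have h31' : |∑ l ∈ range n, At i l * Bt l j - Chat i j| ≤ θ * ((1 + ul) ^ 2 * S) :=
    le_trans h31 (mul_le_mul_of_nonneg_left hconv hθ0)
  calc |∑ l ∈ range n, A i l * B l j - Chat i j|
      ≤ (2 * ul + ul ^ 2) * S + θ * ((1 + ul) ^ 2 * S) := le_trans htri (add_le_add hdata h31')
    _ = (2 * ul + ul ^ 2 + θ * (1 + ul) ^ 2) * S := by ring

/-! ## Tables 3.1–3.3: the constant of (3.5) in the particular cases (exact forms) -/

omit [LinearOrder K] [IsStrictOrderedRing K] in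
/-- `γ_n(0) = 0`: an exact accumulation contributes nothing. [cite: BlanchardHighamLopezMaryPranesh2020, §3.2 Table 3.1 (rows `u = 0`)] -/
theorem gamma_unit_zero (n : ℕ) : gamma (0 : K) n = 0 := by
  simp [gamma]

omit [LinearOrder K] [IsStrictOrderedRing K] in
/-- Table 3.1 / Table 3.3, the rows with `u = u_FMA` (so `ũ_FMA = 0`; in particular TC16 and TC32):
the constant of (3.5) is exactly `γ_n(u)` — first order `nu` (`nu_low` for TC16, `nu_high` for
TC32). [cite: BlanchardHighamLopezMaryPranesh2020, §3.2 Tables 3.1 and 3.3] -/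
theorem const35_of_uTilde_zero (u : K) (q n : ℕ) :
    gamma (0 : K) q + gamma u n + gamma (0 : K) q * gamma u n = gamma u n := by
  rw [gamma_unit_zero]; ring

omit [LinearOrder K] [IsStrictOrderedRing K] in
/-- Table 3.1, the rows with `u = 0` (the block FMA accumulates exactly and rounds once, (2.1)):
the constant of (3.5) is exactly `γ_q(ũ_FMA)` — first order `qũ_FMA`.
[cite: BlanchardHighamLopezMaryPranesh2020, §3.2 Table 3.1 (rows `u = 0`)] -/
theorem const35_of_u_zero (v : K) (q n : ℕ) :
    gamma v q + gamma (0 : K) n + gamma v q * gamma (0 : K) n = gamma v q := by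
  rw [gamma_unit_zero]; ring

/-! ## §4.1: LU factorization and linear systems with a block FMA -/

/-- COROLLARY 4.1 (eq. (4.1)), additive form. `B = A + Σ_{j<q} X_j Y_j` with `A, B ∈ K^{b×b}` in
precision `u_high` and `X_j, Y_j` in precision `u_low`, computed with a `b × b` FMA as the chain
started at the entry `a` of `A` (so the first addition is NOT free — "the `+1` subscript on `γ`
comes from the initial subtraction with `A`"): entrywise
`|B̂ - B| ≤ (γ̃_q^FMA + γ_{n+1} + γ̃_q^FMA γ_{n+1}) (|A| + Σ_j |X_j||Y_j|)`, `n = qb`.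
[cite: BlanchardHighamLopezMaryPranesh2020, §4.1 Corollary 4.1 eq. (4.1)] -/
theorem corollary41 {u v : K} (hu : 0 ≤ u) (hv : 0 ≤ v) {q b : ℕ} (hq : (q : K) * v < 1)
    (hn1 : ((q * b + 1 : ℕ) : K) * u < 1) (c : K) (x y ε δ : ℕ → ℕ → K) (η : ℕ → K)
    (hε : ∀ i k, |ε i k| ≤ u) (hδ : ∀ i k, |δ i k| ≤ u) (hη : ∀ i, |η i| ≤ v) :
    |chainFMA b c x y ε δ η q - (c + ∑ i ∈ range q, ∑ k ∈ range b, x i k * y i k)|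
      ≤ (gamma v q + gamma u (q * b + 1) + gamma v q * gamma u (q * b + 1))
        * (|c| + ∑ i ∈ range q, ∑ k ∈ range b, |x i k| * |y i k|) := by
  rcases Nat.eq_zero_or_pos q with hq0 | hqpos
  · subst hq0
    have hn1' : ((1 : ℕ) : K) * u < 1 := by simpa using hn1
    have hg1 : 0 ≤ gamma u 1 := gamma_nonneg hu hn1'
    have hg0 : gamma v 0 = 0 := by simp [gamma]
    have e0 : |chainFMA b c x y ε δ η 0 - (c + ∑ i ∈ range 0, ∑ k ∈ range b, x i k * y i k)| = 0 := by
      simp [chainFMA]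
    rw [e0, Nat.zero_mul, Nat.zero_add, hg0, Finset.sum_range_zero]
    nlinarith [mul_nonneg hg1 (abs_nonneg c)]
  have hu1 : u ≤ 1 := le_one_of_mul_lt_one (by omega) hn1
  have hv1 : v ≤ 1 := le_one_of_mul_lt_one hqpos hq
  obtain ⟨A, C, a, d, hA, hC, had, heq⟩ := chainFMA_backward hu hu1 hv hv1 b c x y ε δ η hε hδ hη q
  set θ := gamma v q + gamma u (q * b + 1) + gamma v q * gamma u (q * b + 1) with hθ
  rw [heq]
  have e : c * (A * C) + ∑ i' ∈ range q, ∑ k ∈ range b, x i' k * y i' k * (a i' k * d i' k)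
        - (c + ∑ i ∈ range q, ∑ k ∈ range b, x i k * y i k)
      = c * (A * C - 1) + (∑ i' ∈ range q, ∑ k ∈ range b, x i' k * y i' k * (a i' k * d i' k)
          - ∑ i ∈ range q, ∑ k ∈ range b, x i k * y i k) := by ring
  rw [e]
  have h1 : |c * (A * C - 1)| ≤ θ * |c| := by
    rw [abs_mul, mul_comm]
    refine mul_le_mul_of_nonneg_right ?_ (abs_nonneg c)
    exact IsTheta.abs_mul_sub_one_le_gamma hu hu1 hv hv1 hq hn1 hA (hC.mono hu hu1 (Nat.le_succ _))
  have h2 := abs_sum_sum_mul_sub_le x y (fun i k => a i k * d i k) (M := θ) fun i hi k hk => by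
    obtain ⟨ha, hd⟩ := had i hi k hk
    exact IsTheta.abs_mul_sub_one_le_gamma hu hu1 hv hv1 hq hn1 (ha.mono hv hv1 (Nat.sub_le q i)) hd
  calc _ ≤ θ * |c| + θ * ∑ i ∈ range q, ∑ k ∈ range b, |x i k| * |y i k| :=
        le_trans (abs_add_le _ _) (add_le_add h1 h2)
    _ = _ := by ring

/-- COROLLARY 4.1 as printed, `B = A - Σ_{j<q} X_j Y_j`: the chain is fed the negated entries of the
`X_j` (negation is exact), and `|-x| = |x|`.
[cite: BlanchardHighamLopezMaryPranesh2020, §4.1 Corollary 4.1 eq. (4.1)] -/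
theorem corollary41_sub {u v : K} (hu : 0 ≤ u) (hv : 0 ≤ v) {q b : ℕ} (hq : (q : K) * v < 1)
    (hn1 : ((q * b + 1 : ℕ) : K) * u < 1) (a : K) (x y ε δ : ℕ → ℕ → K) (η : ℕ → K)
    (hε : ∀ i k, |ε i k| ≤ u) (hδ : ∀ i k, |δ i k| ≤ u) (hη : ∀ i, |η i| ≤ v) :
    |chainFMA b a (fun j k => -x j k) y ε δ η q - (a - ∑ j ∈ range q, ∑ k ∈ range b, x j k * y j k)|
      ≤ (gamma v q + gamma u (q * b + 1) + gamma v q * gamma u (q * b + 1))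
        * (|a| + ∑ j ∈ range q, ∑ k ∈ range b, |x j k| * |y j k|) := by
  have h := corollary41 hu hv hq hn1 a (fun j k => -x j k) y ε δ η hε hδ hη
  have e1 : a + ∑ i ∈ range q, ∑ k ∈ range b, -x i k * y i k
      = a - ∑ j ∈ range q, ∑ k ∈ range b, x j k * y j k := by
    simp only [neg_mul, Finset.sum_neg_distrib]
    ring
  have e2 : ∑ i ∈ range q, ∑ k ∈ range b, |(-x i k)| * |y i k|
      = ∑ j ∈ range q, ∑ k ∈ range b, |x j k| * |y j k| := by
    simp only [abs_neg]
  rw [e1, e2] at h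
  exact h

/-- THEOREM 4.3, ONE ENTRY OF ONE BLOCK (the proof's chain of inequalities up to (4.6), assembled
from its three published ingredients). Fix block position `(i, k)` of Algorithm 4.1 and an entry
of that block; write `a` for the entry of `A_ik`; `lh j t`, `uh j t` (`j ∈ J` = the previous block
indices, `t ∈ T` = the `b` inner positions) for the entries of the computed factors `L̂_ij`, `Û_jk`
meeting at this entry, `l̃ = l̂(1 + e)`, `ũ = û(1 + f)` their conversions to precision `u_low`
(`|e|, |f| ≤ u_low`, line 8); `R̂` for the computed entry of `R_ik = A_ik - Σ_j L̃_ij Ũ_jk` with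
the Corollary 4.1 bound `|R̂ - R| ≤ θ₁ (|a| + Σ |l̃||ũ|)` (`θ₁ = γ̃_{q-1}^FMA + γ_{n-b+1} + γ̃γ`);
and `Σ_t lk t · uk t` for the entry of `L̂_ik Û_kk` with (4.5) `|L̂_ik Û_kk - R̂_ik| ≤ θ₂ |L̂_ik||Û_kk|`
(`θ₂ = γ_b`, Lemma 4.2 = [17, Thms. 9.3, 8.5] — for `i = k` by (4.2), for `i < k` with the roles
of `L` and `U` exchanged). CONCLUSION (4.6): `|a - (Σ_j Σ_t l̂ û + Σ_t lk uk)| ≤ (2u_low + u_low² +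
max(θ₁, θ₂)(1 + u_low)²)(|a| + Σ_j Σ_t |l̂||û| + Σ_t |lk||uk|)` — i.e. (4.4) at this entry, since
`Σ_{j≤k} L̂_ij Û_jk` is the full entry of `L̂Û` by block triangularity.
[cite: BlanchardHighamLopezMaryPranesh2020, §4.1 Theorem 4.3 eqs. (4.4)–(4.6)] -/
theorem theorem43_entry {J T : Type*} (sJ : Finset J) (sT : Finset T) {ul θ₁ θ₂ : K}
    (hul : 0 ≤ ul) (hθ₁ : 0 ≤ θ₁) (a Rhat : K) (lh uh e f : J → T → K)
    (lk uk : T → K) (he : ∀ j ∈ sJ, ∀ t ∈ sT, |e j t| ≤ ul) (hf : ∀ j ∈ sJ, ∀ t ∈ sT, |f j t| ≤ ul)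
    (hR : |Rhat - (a - ∑ j ∈ sJ, ∑ t ∈ sT, (lh j t * (1 + e j t)) * (uh j t * (1 + f j t)))|
      ≤ θ₁ * (|a| + ∑ j ∈ sJ, ∑ t ∈ sT, |lh j t * (1 + e j t)| * |uh j t * (1 + f j t)|))
    (h45 : |∑ t ∈ sT, lk t * uk t - Rhat| ≤ θ₂ * ∑ t ∈ sT, |lk t| * |uk t|) :
    |a - (∑ j ∈ sJ, ∑ t ∈ sT, lh j t * uh j t + ∑ t ∈ sT, lk t * uk t)|
      ≤ (2 * ul + ul ^ 2 + max θ₁ θ₂ * (1 + ul) ^ 2)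
        * (|a| + (∑ j ∈ sJ, ∑ t ∈ sT, |lh j t| * |uh j t| + ∑ t ∈ sT, |lk t| * |uk t|)) := by
  set St := ∑ j ∈ sJ, ∑ t ∈ sT, (lh j t * (1 + e j t)) * (uh j t * (1 + f j t)) with hSt
  set S := ∑ j ∈ sJ, ∑ t ∈ sT, lh j t * uh j t with hS
  set Stabs := ∑ j ∈ sJ, ∑ t ∈ sT, |lh j t * (1 + e j t)| * |uh j t * (1 + f j t)| with hStabs
  set Sabs := ∑ j ∈ sJ, ∑ t ∈ sT, |lh j t| * |uh j t| with hSabs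
  set G := ∑ t ∈ sT, lk t * uk t with hG
  set Gabs := ∑ t ∈ sT, |lk t| * |uk t| with hGabs
  set M := max θ₁ θ₂ with hM
  have hM1 : θ₁ ≤ M := le_max_left _ _
  have hM2 : θ₂ ≤ M := le_max_right _ _
  have hM0 : 0 ≤ M := le_trans hθ₁ hM1
  have ha0 := abs_nonneg a
  have hSabs0 : 0 ≤ Sabs := Finset.sum_nonneg fun j _ =>
    Finset.sum_nonneg fun t _ => mul_nonneg (abs_nonneg _) (abs_nonneg _)
  have hStabs0 : 0 ≤ Stabs := Finset.sum_nonneg fun j _ =>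
    Finset.sum_nonneg fun t _ => mul_nonneg (abs_nonneg _) (abs_nonneg _)
  have hGabs0 : 0 ≤ Gabs := Finset.sum_nonneg fun t _ => mul_nonneg (abs_nonneg _) (abs_nonneg _)
  -- (5) `Σ |l̃||ũ| ≤ (1 + u_low)² Σ |l̂||û|`
  have h5 : Stabs ≤ (1 + ul) ^ 2 * Sabs := by
    rw [hStabs, hSabs, Finset.mul_sum]
    refine Finset.sum_le_sum fun j hj => ?_
    rw [Finset.mul_sum]
    refine Finset.sum_le_sum fun t ht => ?_
    rw [abs_mul, abs_mul]
    have h1 : |1 + e j t| ≤ 1 + ul := by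
      refine le_trans (abs_add_le _ _) ?_
      rw [abs_one]; linarith [he j hj t ht]
    have h2 : |1 + f j t| ≤ 1 + ul := by
      refine le_trans (abs_add_le _ _) ?_
      rw [abs_one]; linarith [hf j hj t ht]
    have h12 : |1 + e j t| * |1 + f j t| ≤ (1 + ul) * (1 + ul) :=
      mul_le_mul h1 h2 (abs_nonneg _) (by linarith)
    have h0 : 0 ≤ |lh j t| * |uh j t| := mul_nonneg (abs_nonneg _) (abs_nonneg _)
    calc |lh j t| * |1 + e j t| * (|uh j t| * |1 + f j t|)
        = (|lh j t| * |uh j t|) * (|1 + e j t| * |1 + f j t|) := by ring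
      _ ≤ (|lh j t| * |uh j t|) * ((1 + ul) * (1 + ul)) := mul_le_mul_of_nonneg_left h12 h0
      _ = (1 + ul) ^ 2 * (|lh j t| * |uh j t|) := by ring
  -- (4) `|Σ l̃ũ - Σ l̂û| = |G| ≤ (2u_low + u_low²) Σ |l̂||û|`
  have h4 : |St - S| ≤ (2 * ul + ul ^ 2) * Sabs := by
    have e1 : St - S = ∑ j ∈ sJ, ∑ t ∈ sT, lh j t * uh j t * ((1 + e j t) * (1 + f j t) - 1) := by
      rw [hSt, hS, ← Finset.sum_sub_distrib]
      refine Finset.sum_congr rfl fun j _ => ?_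
      rw [← Finset.sum_sub_distrib]
      exact Finset.sum_congr rfl fun t _ => by ring
    rw [e1, hSabs, Finset.mul_sum]
    refine le_trans (Finset.abs_sum_le_sum_abs _ _) (Finset.sum_le_sum fun j hj => ?_)
    rw [Finset.mul_sum]
    refine le_trans (Finset.abs_sum_le_sum_abs _ _) (Finset.sum_le_sum fun t ht => ?_)
    rw [abs_mul, abs_mul]
    have h := abs_one_add_mul_one_add_sub_one_le (he j hj t ht) (hf j hj t ht)
    have e2 : (1 + ul) * (1 + ul) - 1 = 2 * ul + ul ^ 2 := by ring
    rw [e2] at h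
    have h0 : 0 ≤ |lh j t| * |uh j t| := mul_nonneg (abs_nonneg _) (abs_nonneg _)
    calc |lh j t| * |uh j t| * |(1 + e j t) * (1 + f j t) - 1|
        ≤ |lh j t| * |uh j t| * (2 * ul + ul ^ 2) := mul_le_mul_of_nonneg_left h h0
      _ = (2 * ul + ul ^ 2) * (|lh j t| * |uh j t|) := by ring
  -- (1)–(3): `|a - Σ l̃ũ - Σ lk uk| ≤ θ₁(|a| + Σ|l̃||ũ|) + θ₂ Σ|lk||uk|`
  have h3 : |a - St - G| ≤ θ₁ * (|a| + Stabs) + θ₂ * Gabs := by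
    have e1 : a - St - G = -(Rhat - (a - St)) - (G - Rhat) := by ring
    rw [e1]
    refine le_trans (abs_sub _ _) (add_le_add ?_ h45)
    rw [abs_neg]; exact hR
  -- (6) assemble
  have e6 : a - (S + G) = (a - St - G) + (St - S) := by ring
  rw [e6]
  have h6 : |a - St - G + (St - S)| ≤ θ₁ * (|a| + Stabs) + θ₂ * Gabs + (2 * ul + ul ^ 2) * Sabs :=
    le_trans (abs_add_le _ _) (add_le_add h3 h4)
  refine le_trans h6 ?_
  have hsq : (1 : K) ≤ (1 + ul) ^ 2 := by nlinarith
  have k1 : θ₁ * (|a| + Stabs) ≤ M * (1 + ul) ^ 2 * (|a| + Sabs) := by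
    calc θ₁ * (|a| + Stabs) ≤ M * (|a| + (1 + ul) ^ 2 * Sabs) :=
          mul_le_mul hM1 (by linarith) (by positivity) hM0
      _ ≤ M * ((1 + ul) ^ 2 * |a| + (1 + ul) ^ 2 * Sabs) := by
          apply mul_le_mul_of_nonneg_left _ hM0
          nlinarith
      _ = M * (1 + ul) ^ 2 * (|a| + Sabs) := by ring
  have k2 : θ₂ * Gabs ≤ M * (1 + ul) ^ 2 * Gabs := by
    have : θ₂ ≤ M * (1 + ul) ^ 2 := le_trans hM2 (by nlinarith)
    exact mul_le_mul_of_nonneg_right this hGabs0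
  have k3 : (2 * ul + ul ^ 2) * Sabs ≤ (2 * ul + ul ^ 2) * (|a| + (Sabs + Gabs)) := by
    apply mul_le_mul_of_nonneg_left _ (by positivity)
    linarith
  nlinarith

/-- THEOREM 4.4 (eq. (4.7)): if the computed LU factors satisfy the entrywise backward bound of
Theorem 4.3, `|L̂Û - A| ≤ c (|A| + |L̂||Û|)`, and the two substitutions are backward stable in the
sense of [17, Thm. 8.5] — `(L̂ + ΔL)ŷ = b`, `|ΔL| ≤ g|L̂|`, `(Û + ΔU)x̂ = ŷ`, `|ΔU| ≤ g|Û|` (`g =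
γ_n`) — then `(A + ΔA)x̂ = b` with `|ΔA| ≤ (c + 2g + g²)(|A| + |L̂||Û|)`; the proof is that of
[17, Thm. 9.4]. [cite: BlanchardHighamLopezMaryPranesh2020, §4.1 Theorem 4.4 eq. (4.7)] -/
theorem theorem44 {n : Type*} [Fintype n] (A L U ΔL ΔU : Matrix n n K) (bv xh yh : n → K)
    {c g : K} (hg : 0 ≤ g)
    (hLU : ∀ i j, |(L * U) i j - A i j| ≤ c * (|A i j| + ∑ k, |L i k| * |U k j|))
    (hy : (L + ΔL).mulVec yh = bv) (hΔL : ∀ i j, |ΔL i j| ≤ g * |L i j|)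
    (hx : (U + ΔU).mulVec xh = yh) (hΔU : ∀ i j, |ΔU i j| ≤ g * |U i j|) :
    ∃ ΔA : Matrix n n K, (A + ΔA).mulVec xh = bv ∧
      ∀ i j, |ΔA i j| ≤ (c + 2 * g + g ^ 2) * (|A i j| + ∑ k, |L i k| * |U k j|) := by
  refine ⟨(L + ΔL) * (U + ΔU) - A, ?_, fun i j => ?_⟩
  · rw [add_sub_cancel, ← Matrix.mulVec_mulVec, hx, hy]
  · have e : ((L + ΔL) * (U + ΔU) - A) i j
        = ((L * U) i j - A i j) + ∑ k, (L i k * ΔU k j + ΔL i k * U k j + ΔL i k * ΔU k j) := by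
      have e1 : ((L + ΔL) * (U + ΔU)) i j
          = (L * U) i j + ∑ k, (L i k * ΔU k j + ΔL i k * U k j + ΔL i k * ΔU k j) := by
        rw [Matrix.mul_apply, Matrix.mul_apply, ← Finset.sum_add_distrib]
        refine Finset.sum_congr rfl fun k _ => ?_
        rw [Matrix.add_apply, Matrix.add_apply]
        ring
      rw [Matrix.sub_apply, e1]
      ring
    rw [e]
    set S := ∑ k, |L i k| * |U k j| with hS
    have hS0 : 0 ≤ S := Finset.sum_nonneg fun k _ => mul_nonneg (abs_nonneg _) (abs_nonneg _)
    have h2 : |∑ k, (L i k * ΔU k j + ΔL i k * U k j + ΔL i k * ΔU k j)| ≤ (2 * g + g ^ 2) * S := by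
      rw [hS, Finset.mul_sum]
      refine le_trans (Finset.abs_sum_le_sum_abs _ _) (Finset.sum_le_sum fun k _ => ?_)
      have hL := abs_nonneg (L i k)
      have hU := abs_nonneg (U k j)
      have t1 : |L i k * ΔU k j| ≤ g * (|L i k| * |U k j|) := by
        rw [abs_mul]
        calc |L i k| * |ΔU k j| ≤ |L i k| * (g * |U k j|) := mul_le_mul_of_nonneg_left (hΔU k j) hL
          _ = g * (|L i k| * |U k j|) := by ring
      have t2 : |ΔL i k * U k j| ≤ g * (|L i k| * |U k j|) := by
        rw [abs_mul]
        calc |ΔL i k| * |U k j| ≤ g * |L i k| * |U k j| := mul_le_mul_of_nonneg_right (hΔL i k) hU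
          _ = g * (|L i k| * |U k j|) := by ring
      have t3 : |ΔL i k * ΔU k j| ≤ g ^ 2 * (|L i k| * |U k j|) := by
        rw [abs_mul]
        calc |ΔL i k| * |ΔU k j| ≤ g * |L i k| * (g * |U k j|) :=
              mul_le_mul (hΔL i k) (hΔU k j) (abs_nonneg _) (mul_nonneg hg hL)
          _ = g ^ 2 * (|L i k| * |U k j|) := by ring
      calc |L i k * ΔU k j + ΔL i k * U k j + ΔL i k * ΔU k j|
          ≤ |L i k * ΔU k j| + |ΔL i k * U k j| + |ΔL i k * ΔU k j| := abs_add_three _ _ _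
        _ ≤ g * (|L i k| * |U k j|) + g * (|L i k| * |U k j|) + g ^ 2 * (|L i k| * |U k j|) :=
            add_le_add (add_le_add t1 t2) t3
        _ = (2 * g + g ^ 2) * (|L i k| * |U k j|) := by ring
    have hA0 := abs_nonneg (A i j)
    calc |(L * U) i j - A i j + ∑ k, (L i k * ΔU k j + ΔL i k * U k j + ΔL i k * ΔU k j)|
        ≤ c * (|A i j| + S) + (2 * g + g ^ 2) * S :=
          le_trans (abs_add_le _ _) (add_le_add (hLU i j) h2)
      _ ≤ c * (|A i j| + S) + (2 * g + g ^ 2) * (|A i j| + S) := by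
          have : (2 * g + g ^ 2) * S ≤ (2 * g + g ^ 2) * (|A i j| + S) :=
            mul_le_mul_of_nonneg_left (by linarith) (by positivity)
          linarith
      _ = (c + 2 * g + g ^ 2) * (|A i j| + S) := by ring

end Literature.ComputerArithmetic.BlanchardHighamLopezMaryPranesh2020
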